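import Summits.CriticalPhenomena.CardyFormulaZ2.Theorems.CardyMagicRigidityPinchResamplingDefs
import Summits.CriticalPhenomena.CardyFormulaZ2.Theorems.CardyMagicRigidityNestingRigidityCouplingCrossMultiply
import Summits.CriticalPhenomena.CardyFormulaZ2.Theorems.CardyMagicRigidityNestingRigidityOneGenerationTLocality
import HarnessLib

/-!
# `FourArmCouplingT` is equivalent to its quenched form; exterior events weight ring cylinders

Crux `Summit.CriticalPhenomena.CardyFormulaZ2.Theses.CardyMagicRigidity.NestingRigidity`
(stmt-CriticalPhenomena-4835), line `pinch-resampling` v2 (definitions module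
`CardyMagicRigidityPinchResamplingDefs`), helper toward the registered stub
`stub_fourArmCouplingT : FourArmCouplingT` (S2: exterior forgetting, in total variation, for critical site
percolation on `𝕋` conditioned on the pinch event `TPinch x y m n`).

`FourArmCouplingT` is stated CROSS-MULTIPLIED: for exterior events `F, F'` of `Λ_n(x)` and an interior event
`E` of `Λ_s(y)`,
`|P(E ∩ Pinch ∩ F) P(Pinch ∩ F') - P(E ∩ Pinch ∩ F') P(Pinch ∩ F)| ≤ b P(Pinch ∩ F) P(Pinch ∩ F')`.
The published coupling property (Garban–Pete–Schramm, *Pivotal, cluster and interface measures for critical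
planar percolation*, arXiv:1008.1378, Prop. 11) is QUENCHED: the conditional law given the four-arm event and
a boundary condition is close to ONE reference law.  This file records the elementary passages between the
forms (the real-number algebra is `CardyMagicRigidityNestingRigidityCouplingCrossMultiply`):

* §1 `fourArmCouplingT_of_quenched` (registered anchor) — the quenched statement "for every interior `E`
  there is `ν` with `|P(E ∩ Pinch ∩ F) - ν P(Pinch ∩ F)| ≤ (b/2) P(Pinch ∩ F)` for all exterior `F`", with
  the quantifier prefix of `FourArmCouplingT`, implies `FourArmCouplingT`; `quenched_of_fourArmCouplingT` —
  conversely `FourArmCouplingT` implies the quenched statement with `ν = P(E ∩ Pinch) / P(Pinch)` and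
  constant `b` (take `F' = univ`).  So stub S2 is exactly the quenched exterior-forgetting statement,
  uniformly over ALL exterior events `F` determined off `Λ_n(x)`.
* §2 (generic, any `sitePercolation V p`) **exterior events act on ring cylinders as nonnegative weights**:
  if `A` is determined by `K_A`, `F` by `K_F` and a countable "ring" `R` separates them (`K_A ∖ R` disjoint
  from `K_F`), then `P(A ∩ F ∩ C_ζ) = P(F_ζ) P(A ∩ C_ζ)` on every cylinder `C_ζ = localCylinder R ζ`, with
  the weight `P(F_ζ)` (probability of the `ζ`-section of `F`) not depending on `A`
  (`measureReal_inter_inter_localCylinder`: conditional independence given the ring, from the product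
  structure `measureReal_inter_of_determined`); the cylinders of a finite ring partition the space
  (`measureReal_eq_sum_inter_localCylinder`); hence quenched bounds on all cylinders of a finite ring, with
  one reference value, give the quenched bound for every exterior event (`quenched_of_cylinders`).  The
  site-`𝕋` instance — `FourArmCouplingT` from quenched bounds over the colourings of the ring
  `Λ_{2n}(x) ∖ Λ_n(x)` — is `fourArmCouplingT_of_cylinders` in `…NestingRigidityFourArmCouplingTRingPatterns`.
-/

noncomputable section

namespace Summit.CriticalPhenomena.CardyFormulaZ2.Cruxes.NestingRigidity.PinchResampling

open MeasureTheory Set Literature.Probability.Percolation Literature.Probability.LatticeModels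

/-! ## §1 `FourArmCouplingT` from its quenched (reference-value) form, and back -/

section Reduction

/-- **Reduction of stub S2 to the quenched coupling statement (registered helper).**  The published form of
the four-arm coupling property (Garban–Pete–Schramm, arXiv:1008.1378, Prop. 11) is QUENCHED: for every
interior event `E` there is a reference value `ν` (the probability of `E` under a fixed reference
conditioning) such that, for every exterior event `F`, `P(E ∩ Pinch ∩ F)` is within `(b/2) P(Pinch ∩ F)` of
`ν P(Pinch ∩ F)`.  Two such bounds with the same `ν` give the cross-multiplied total-variation form
`FourArmCouplingT` (`abs_crossMul_le_of_quenched`: expand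
`p q' - p' q = (p - ν q) q' - (p' - ν q') q`).  So S2 follows from the quenched statement with the same
scale ratio `M(b)`. -/
theorem fourArmCouplingT_of_quenched : (∀ b : ℝ, 0 < b → ∃ M : ℕ, ∀ (x y : Site 2) (m s n : ℕ), m ≤ s → 2 * triNorm (y - x) + 2 * s ≤ n → M * s ≤ n → ∀ E : Set (SiteConfig (Site 2)), MeasurableSet E → DeterminedBy E (tInt y s) → ∃ ν : ℝ, ∀ F : Set (SiteConfig (Site 2)), MeasurableSet F → DeterminedBy F (tBall x n)ᶜ → |(triSitePercolation half).real (E ∩ TPinch x y m n ∩ F) - ν * (triSitePercolation half).real (TPinch x y m n ∩ F)| ≤ b / 2 * (triSitePercolation half).real (TPinch x y m n ∩ F)) → FourArmCouplingT := by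
  intro hQ b hb
  obtain ⟨M, hM⟩ := hQ b hb
  refine ⟨M, fun x y m s n hms hn hMn F F' hFm hF'm hF hF' E hEm hE ↦ ?_⟩
  obtain ⟨ν, hν⟩ := hM x y m s n hms hn hMn E hEm hE
  exact abs_crossMul_le_of_quenched (triSitePercolation half) (TPinch x y m n) E F F' ν b (hν F hFm hF)
    (hν F' hF'm hF')

/-- **Conversely, `FourArmCouplingT` gives the quenched form** with the conditional probability
`ν = P(E ∩ Pinch) / P(Pinch)` as reference value (take `F' = univ`, an exterior event, and divide by
`P(Pinch)`; `quenched_of_abs_crossMul_le_univ`), with constant `b` in place of `b / 2`.  Hence stub S2 is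
EQUIVALENT to the quenched exterior-forgetting statement, uniformly over all exterior events `F`. -/
theorem quenched_of_fourArmCouplingT (h : FourArmCouplingT) (b : ℝ) (hb : 0 < b) :
    ∃ M : ℕ, ∀ (x y : Site 2) (m s n : ℕ), m ≤ s → 2 * triNorm (y - x) + 2 * s ≤ n → M * s ≤ n →
      ∀ E : Set (SiteConfig (Site 2)), MeasurableSet E → DeterminedBy E (tInt y s) → ∃ ν : ℝ,
        ∀ F : Set (SiteConfig (Site 2)), MeasurableSet F → DeterminedBy F (tBall x n)ᶜ →
          |(triSitePercolation half).real (E ∩ TPinch x y m n ∩ F) -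
              ν * (triSitePercolation half).real (TPinch x y m n ∩ F)| ≤
            b * (triSitePercolation half).real (TPinch x y m n ∩ F) := by
  obtain ⟨M, hM⟩ := h b hb
  refine ⟨M, fun x y m s n hms hn hMn E hEm hE ↦
    ⟨(triSitePercolation half).real (E ∩ TPinch x y m n) / (triSitePercolation half).real (TPinch x y m n),
      fun F hFm hF ↦ ?_⟩⟩
  exact quenched_of_abs_crossMul_le_univ (triSitePercolation half)
    (hM x y m s n hms hn hMn F univ hFm MeasurableSet.univ hF (determinedBy_univ _) E hEm hE)

end Reduction

/-! ## §2 Exterior events act on the cylinders of a ring as nonnegative weights -/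

section Cylinders

variable {V : Type*}

/-- Membership in the cylinder of `ζ` over `K` is agreement with `ζ` on `K`. -/
theorem mem_localCylinder_iff_inter_eq {K ζ ω : Set V} : ω ∈ localCylinder K ζ ↔ ω ∩ K = ζ ∩ K := by
  simp only [localCylinder, mem_setOf_eq, Set.ext_iff, mem_inter_iff]
  exact ⟨fun h i ↦ ⟨fun ⟨hω, hi⟩ ↦ ⟨(h i hi).1 hω, hi⟩, fun ⟨hζ, hi⟩ ↦ ⟨(h i hi).2 hζ, hi⟩⟩,
    fun h i hi ↦ ⟨fun hω ↦ ((h i).1 ⟨hω, hi⟩).1, fun hζ ↦ ((h i).2 ⟨hζ, hi⟩).1⟩⟩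

/-- Cylinders over `K` are determined by `K`. -/
theorem determinedBy_localCylinder (K ζ : Set V) : DeterminedBy (localCylinder K ζ) K := by
  rw [determinedBy_iff]
  intro ω ω' h
  rw [mem_localCylinder_iff_inter_eq, mem_localCylinder_iff_inter_eq, h]

/-- The splice `ω ↦ (ω ∖ R) ∪ (ζ ∩ R)` (impose the pattern `ζ` on `R`) is measurable. -/
theorem measurable_splice (R ζ : Set V) : Measurable fun ω : Set V ↦ ω \ R ∪ ζ ∩ R := by
  refine measurable_set_iff.2 fun a ↦ ?_
  simp only [mem_union, Set.mem_sdiff, mem_inter_iff]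
  exact ((measurable_set_mem a).and measurable_const).or measurable_const

/-- On the cylinder of `ζ` over `R`, membership in any event `B` is membership of the splice. -/
theorem mem_iff_splice_mem_of_mem_localCylinder {R ζ : Set V} {ω : Set V} (hω : ω ∈ localCylinder R ζ)
    (B : Set (Set V)) : ω ∈ B ↔ ω \ R ∪ ζ ∩ R ∈ B := by
  rw [mem_localCylinder_iff_inter_eq] at hω
  rw [← hω, Set.sdiff_union_inter]

/-- The `ζ`-section over `R` of an event determined by `K` is determined by `K ∖ R`. -/
theorem determinedBy_section {A : Set (Set V)} {K : Set V} (hA : DeterminedBy A K) (R ζ : Set V) :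
    DeterminedBy {ω | ω \ R ∪ ζ ∩ R ∈ A} (K \ R) := by
  rw [determinedBy_iff] at hA ⊢
  intro ω ω' h
  simp only [mem_setOf_eq]
  refine hA _ _ ?_
  have key : ∀ ω : Set V, (ω \ R ∪ ζ ∩ R) ∩ K = ω ∩ (K \ R) ∪ ζ ∩ R ∩ K := by
    intro ω
    ext i
    simp only [mem_inter_iff, mem_union, Set.mem_sdiff]
    tauto
  rw [key, key, h]

/-- The `ζ`-section of a measurable event is measurable. -/
theorem measurableSet_section {A : Set (Set V)} (hA : MeasurableSet A) (R ζ : Set V) :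
    MeasurableSet {ω | ω \ R ∪ ζ ∩ R ∈ A} :=
  hA.preimage (measurable_splice R ζ)

/-- An event determined by `S` is unchanged by restricting the configuration to `S` (private copy of
`inter_mem_iff_of_determinedBy` of `…NestingRigidityPinchLocality`, which is not imported here). -/
private theorem inter_mem_iff_of_determinedBy_aux {ι : Type*} {A : Set (Set ι)} {S : Set ι}
    (h : DeterminedBy A S) (ω : Set ι) : ω ∩ S ∈ A ↔ ω ∈ A :=
  (determinedBy_iff A S).1 h (ω ∩ S) ω (by rw [inter_assoc, inter_self])

/-- Independence of events determined by disjoint sets of sites under `sitePercolation V p`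
(`DeterminedBy` form of `measureReal_inter_of_determined`). -/
theorem measureReal_inter_of_determinedBy (p : unitInterval) {S T : Set V} (hST : Disjoint S T)
    {A B : Set (SiteConfig V)} (hAm : MeasurableSet A) (hBm : MeasurableSet B) (hA : DeterminedBy A S)
    (hB : DeterminedBy B T) :
    (sitePercolation V p).real (A ∩ B) = (sitePercolation V p).real A * (sitePercolation V p).real B :=
  MarkovCascadeOneGeneration.measureReal_inter_of_determined p hST hAm hBm
    (inter_mem_iff_of_determinedBy_aux hA) (inter_mem_iff_of_determinedBy_aux hB)

/-- **Exterior events weight the cylinders of the ring.**  Let `A` be determined by `K_A`, `F` by `K_F`, and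
let the ring `R` (countable) separate them: `K_A ∖ R` is disjoint from `K_F`.  Then on each cylinder `C_ζ` of
the ring, `μ(A ∩ F ∩ C_ζ) = μ(F_ζ) μ(A ∩ C_ζ)` with the weight `μ(F_ζ)` (the probability of the `ζ`-section
of `F`) NOT depending on `A` — the conditional independence of `σ(K_A)` and `σ(K_F)` given the ring, for the
product measure `sitePercolation V p`. -/
theorem measureReal_inter_inter_localCylinder (p : unitInterval) {R K_A K_F : Set V} (hR : R.Countable)
    (hdisj : Disjoint (K_A \ R) K_F) {A F : Set (SiteConfig V)} (hAm : MeasurableSet A) (hFm : MeasurableSet F)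
    (hA : DeterminedBy A K_A) (hF : DeterminedBy F K_F) (ζ : Set V) :
    (sitePercolation V p).real (A ∩ F ∩ localCylinder R ζ) =
      (sitePercolation V p).real {ω | ω \ R ∪ ζ ∩ R ∈ F} *
        (sitePercolation V p).real (A ∩ localCylinder R ζ) := by
  set C := localCylinder R ζ with hC
  set Aζ : Set (Set V) := {ω | ω \ R ∪ ζ ∩ R ∈ A} with hAζ
  set Fζ : Set (Set V) := {ω | ω \ R ∪ ζ ∩ R ∈ F} with hFζ
  have hCm : MeasurableSet C := measurableSet_localCylinder hR ζ
  have hCd : DeterminedBy C R := determinedBy_localCylinder R ζ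
  have hAζd : DeterminedBy Aζ (K_A \ R) := determinedBy_section hA R ζ
  have hFζd : DeterminedBy Fζ (K_F \ R) := determinedBy_section hF R ζ
  have hAζm : MeasurableSet Aζ := measurableSet_section hAm R ζ
  have hFζm : MeasurableSet Fζ := measurableSet_section hFm R ζ
  have h1 : A ∩ F ∩ C = Aζ ∩ (Fζ ∩ C) := by
    ext ω
    constructor
    · rintro ⟨⟨hA', hF'⟩, hC'⟩
      exact ⟨(mem_iff_splice_mem_of_mem_localCylinder hC' A).1 hA',
        (mem_iff_splice_mem_of_mem_localCylinder hC' F).1 hF', hC'⟩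
    · rintro ⟨hA', hF', hC'⟩
      exact ⟨⟨(mem_iff_splice_mem_of_mem_localCylinder hC' A).2 hA',
        (mem_iff_splice_mem_of_mem_localCylinder hC' F).2 hF'⟩, hC'⟩
  have h2 : A ∩ C = Aζ ∩ C := by
    ext ω
    constructor
    · rintro ⟨hA', hC'⟩
      exact ⟨(mem_iff_splice_mem_of_mem_localCylinder hC' A).1 hA', hC'⟩
    · rintro ⟨hA', hC'⟩
      exact ⟨(mem_iff_splice_mem_of_mem_localCylinder hC' A).2 hA', hC'⟩
  have hX : Disjoint (K_A \ R) (K_F \ R ∪ R) :=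
    disjoint_union_right.2 ⟨hdisj.mono_right fun _ hv ↦ hv.1, disjoint_sdiff_left⟩
  have i1 := measureReal_inter_of_determinedBy p hX hAζm (hFζm.inter hCm) hAζd
    ((hFζd.mono subset_union_left).inter (hCd.mono subset_union_right))
  have i2 := measureReal_inter_of_determinedBy p disjoint_sdiff_left hFζm hCm hFζd hCd
  have i3 := measureReal_inter_of_determinedBy p disjoint_sdiff_left hAζm hCm hAζd hCd
  rw [h1, h2, i1, i2, i3]
  ring

/-- **The cylinders of a finite ring partition the space**: `μ(B) = Σ_{ζ ⊆ R} μ(B ∩ C_ζ)`. -/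
theorem measureReal_eq_sum_inter_localCylinder (μ : Measure (Set V)) [IsFiniteMeasure μ] (R : Finset V)
    {B : Set (Set V)} (hB : MeasurableSet B) :
    μ.real B = ∑ ζ ∈ R.powerset, μ.real (B ∩ localCylinder (↑R : Set V) (↑ζ : Set V)) := by
  classical
  have hcover : B = ⋃ ζ ∈ R.powerset, B ∩ localCylinder (↑R : Set V) (↑ζ : Set V) := by
    ext ω
    simp only [mem_iUnion, mem_inter_iff, exists_and_left, exists_prop]
    constructor
    · intro hω
      refine ⟨hω, R.filter (· ∈ ω), Finset.mem_powerset.2 (Finset.filter_subset _ _), fun i hi ↦ ?_⟩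
      simp [Finset.mem_coe.1 hi]
    · rintro ⟨hω, -⟩
      exact hω
  have hdisj : (↑R.powerset : Set (Finset V)).PairwiseDisjoint
      fun ζ ↦ B ∩ localCylinder (↑R : Set V) (↑ζ : Set V) := by
    intro ζ hζ ζ' hζ' hne
    rw [Function.onFun, Set.disjoint_left]
    rintro ω ⟨-, h⟩ ⟨-, h'⟩
    have hζR : ζ ⊆ R := Finset.mem_powerset.1 (Finset.mem_coe.1 hζ)
    have hζ'R : ζ' ⊆ R := Finset.mem_powerset.1 (Finset.mem_coe.1 hζ')
    refine hne (Finset.ext fun i ↦ ⟨fun hi ↦ ?_, fun hi ↦ ?_⟩)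
    · exact Finset.mem_coe.1 ((h' i (Finset.mem_coe.2 (hζR hi))).1
        ((h i (Finset.mem_coe.2 (hζR hi))).2 (Finset.mem_coe.2 hi)))
    · exact Finset.mem_coe.1 ((h i (Finset.mem_coe.2 (hζ'R hi))).1
        ((h' i (Finset.mem_coe.2 (hζ'R hi))).2 (Finset.mem_coe.2 hi)))
  conv_lhs => rw [hcover]
  exact measureReal_biUnion_finset hdisj
    (fun ζ _ ↦ hB.inter (measurableSet_localCylinder R.finite_toSet.countable _))

/-- **Quenched bounds on the cylinders of a finite ring give the quenched bound for every exterior event.**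
If `E, T` are determined by `K_A`, `F` by `K_F`, `K_A ∖ R` is disjoint from `K_F` (`R` a finite ring), and
for every pattern `ζ` the probability of `E ∩ T ∩ C_ζ` is within `c μ(T ∩ C_ζ)` of `ν μ(T ∩ C_ζ)` with ONE
reference value `ν`, then `|μ(E ∩ T ∩ F) - ν μ(T ∩ F)| ≤ c μ(T ∩ F)`: decompose over the cylinders and
use that `F` enters each cylinder only through the nonnegative weight `μ(F_ζ)`. -/
theorem quenched_of_cylinders (p : unitInterval) {R : Finset V} {K_A K_F : Set V}
    (hdisj : Disjoint (K_A \ ↑R) K_F) {E T F : Set (SiteConfig V)} (hEm : MeasurableSet E)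
    (hTm : MeasurableSet T) (hFm : MeasurableSet F) (hE : DeterminedBy E K_A) (hT : DeterminedBy T K_A)
    (hF : DeterminedBy F K_F) {ν c : ℝ}
    (hcyl : ∀ ζ : Set V, |(sitePercolation V p).real (E ∩ T ∩ localCylinder ↑R ζ) -
        ν * (sitePercolation V p).real (T ∩ localCylinder ↑R ζ)| ≤
      c * (sitePercolation V p).real (T ∩ localCylinder ↑R ζ)) :
    |(sitePercolation V p).real (E ∩ T ∩ F) - ν * (sitePercolation V p).real (T ∩ F)| ≤
      c * (sitePercolation V p).real (T ∩ F) := by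
  classical
  set μ := sitePercolation V p with hμ
  set w : Finset V → ℝ := fun ζ ↦ μ.real {ω | ω \ ↑R ∪ ↑ζ ∩ ↑R ∈ F} with hw
  have hw0 : ∀ ζ, 0 ≤ w ζ := fun ζ ↦ measureReal_nonneg
  have key : ∀ A : Set (SiteConfig V), MeasurableSet A → DeterminedBy A K_A → ∀ ζ : Finset V,
      μ.real (A ∩ F ∩ localCylinder ↑R ↑ζ) = w ζ * μ.real (A ∩ localCylinder ↑R ↑ζ) :=
    fun A hAm hA ζ ↦ measureReal_inter_inter_localCylinder p R.finite_toSet.countable hdisj hAm hFm hA hF ↑ζ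
  have s1 : μ.real (E ∩ T ∩ F) = ∑ ζ ∈ R.powerset, w ζ * μ.real (E ∩ T ∩ localCylinder ↑R ↑ζ) := by
    rw [measureReal_eq_sum_inter_localCylinder μ R ((hEm.inter hTm).inter hFm)]
    exact Finset.sum_congr rfl fun ζ _ ↦ key _ (hEm.inter hTm) (hE.inter hT) ζ
  have s2 : μ.real (T ∩ F) = ∑ ζ ∈ R.powerset, w ζ * μ.real (T ∩ localCylinder ↑R ↑ζ) := by
    rw [measureReal_eq_sum_inter_localCylinder μ R (hTm.inter hFm)]
    exact Finset.sum_congr rfl fun ζ _ ↦ key _ hTm hT ζ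
  rw [s1, s2, Finset.mul_sum, Finset.mul_sum, ← Finset.sum_sub_distrib]
  refine (Finset.abs_sum_le_sum_abs _ _).trans (Finset.sum_le_sum fun ζ _ ↦ ?_)
  have e1 : w ζ * μ.real (E ∩ T ∩ localCylinder ↑R ↑ζ) - ν * (w ζ * μ.real (T ∩ localCylinder ↑R ↑ζ)) =
      w ζ * (μ.real (E ∩ T ∩ localCylinder ↑R ↑ζ) - ν * μ.real (T ∩ localCylinder ↑R ↑ζ)) := by ring
  have e2 : c * (w ζ * μ.real (T ∩ localCylinder ↑R ↑ζ)) = w ζ * (c * μ.real (T ∩ localCylinder ↑R ↑ζ)) := by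
    ring
  rw [e1, e2, abs_mul, abs_of_nonneg (hw0 ζ)]
  exact mul_le_mul_of_nonneg_left (hcyl ↑ζ) (hw0 ζ)

end Cylinders


end Summit.CriticalPhenomena.CardyFormulaZ2.Cruxes.NestingRigidity.PinchResampling

end
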